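import Summits.ResolutionOfSingularities.ResolutionOfSingularities.Theorems.ValuativeLupiMonomial
import Summits.ResolutionOfSingularities.ResolutionOfSingularities.Theorems.ValuativeLupiAbhyankarPlaces
import Summits.ResolutionOfSingularities.ResolutionOfSingularities.Theorems.ValuativeLupiRestriction
import Literature.AlgebraicGeometry.Resolution.PrimeDivisors
import HarnessLib

/-!
# Route `Valuative`, item `Lupi` (stmt-ResolutionOfSingularities-0560): the open case, as reduced in the tree

`Lupi` (absolute local uniformization of the purely inseparable hypersurface function fields
`K = k(x₁, …, xₙ, t)`, `t ^ p ∈ k[x]`, along every valuation ring `O ⊇ k`) is OPEN for `n ≥ 4`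
(Temkin 2013, Rem. 1.3.5(iii); Cutkosky–Mourtada 2019) and closes in one line from the crux
`LuAlphaPTorsor` (`lupi_of_luAlphaPTorsor`, `ValuativeLupi.lean`).  This file assembles the
kernel-checked special cases of the `ValuativeLupi*` files and of the Literature into ONE
reduction statement, i.e. it records precisely which instances of the item remain open in the
tree:

* `lupi_of_reduced_two_full` — UNCONDITIONALLY, `Lupi` follows from its instances with
  - `2 ≤ n` (`n ≤ 1`: `isLocallyUniformizable_of_le_one`, Zariski–Samuel VI §14 via the tree's
    `isLocallyUniformizable_of_trdeg_le_one`);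
  - every `xᵢ ∈ O` (normal form `exists_datum_mem`: centre on the chart `k[x]`);
  - `t ^ p` involving EVERY variable, `t ^ p ∉ k[x_i, i ≠ i₀]` for all `i₀` (otherwise drop the
    idle variable: `isLocallyUniformizable_of_drop`, by induction on `n`, and ascend along it,
    `ValuativeLupiTranscendentalAscent.lean` / `ValuativeLupiRestriction.lean`);
  - `t ^ p` NOT of the shape `c · ∏ xᵢ ^ aᵢ + g ^ p` with `c ∈ k`, `a ∈ ℕⁿ`, `g ∈ k(x)`
    (`isLocallyUniformizable_of_pow_eq_monomial_add_pow`; this single exclusion contains the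
    rational case `t ∈ k(x)` (`c = 0`, `g = t`), the constant case `t ^ p ∈ k` (`a = 0`,
    `g = 0`) and the binomial case);
  - `t ^ p` NOT linear in any one variable, `t ^ p ≠ x_{i₀} · g + h` with `g ≠ 0`, `g, h`
    polynomials in the other variables (`isLocallyUniformizable_of_pow_eq_linear`);
  - the centre of `O` a SINGULAR point of the chart model `k[x, t] ⊆ O`
    (`isLocallyUniformizable_of_isRegularLocalRing_adjoin`: otherwise `k[x, t]` itself uniformizes);
  - `O ≠ K` (`isLocallyUniformizable_top`, `Temkin2013Curves.lean`) and `O` NOT a prime divisor, i.e.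
    `dim O + 1 ≠ trdeg_k K = n` (`isLocallyUniformizable_of_residueTrdeg`, Zariski–Samuel VI §14
    Thm. 31, PROVED in the tree);
  - `O` NOT an Abhyankar place of `K/k` with separably generated residue field extension
    (`isLocallyUniformizable_of_isAbhyankarPlace`, Knaf–Kuhlmann 2005 Thm. 1.1 PROVED in the
    tree).
* `lupi_of_reduced_three_full` / `lupi_of_reduced_full` — the same with `3 ≤ n` / `4 ≤ n`,
  conditionally on the vendored facts `CossartJannsenSaito2020` (`n ≤ 2`:
  `isLocallyUniformizable_of_le_two`) / `CossartPiltant2019` (`n ≤ 3`: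
  `isLocallyUniformizable_of_le_three`).

Log: (1) direct (induction on `n` for the variable drop; case split over the landed special cases).
-/

-- single-problem summit: the doubled namespace component `ResolutionOfSingularities` is forced
set_option linter.dupNamespace false

open IsLocalRing

namespace Summit.ResolutionOfSingularities.ResolutionOfSingularities.Theorems.Lupi

open Summit.ResolutionOfSingularities.ResolutionOfSingularities.Theses.Valuative (Lupi)
open Literature.AlgebraicGeometry.Resolution

/-! ## Regular centre on the chart `k[x, t]` -/

section RegularCentre

variable {k K : Type} [Field k] [Field K] [Algebra k K]

/-- **Regular centre.** If the chart model `k[x, t] ⊆ O` of `K = k(x, t)` is already regular at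
the centre of `O`, then `O` is (trivially) locally uniformizable over `k`: local uniformization
is a statement about the SINGULAR points of the hypersurface `T ^ p = f(x)`. -/
theorem isLocallyUniformizable_of_isRegularLocalRing_adjoin {n : ℕ} (x : Fin n → K) (t : K)
    (htop : IntermediateField.adjoin k (insert t (Set.range x)) = ⊤) (O : ValuationSubring K)
    (hA : (Algebra.adjoin k (insert t (Set.range x))).toSubring ≤ O.toSubring)
    (hreg : IsRegularLocalRing (Localization.AtPrime
      (Ideal.comap (Subring.inclusion hA) (IsLocalRing.maximalIdeal O)))) :
    IsLocallyUniformizable k K O := by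
  classical
  refine ⟨_, hA, ⟨insert t (Finset.univ.image x), ?_⟩, isFractionRing_of_adjoin_eq_top _ ?_, hreg⟩
  · rw [Finset.coe_insert, Finset.coe_image, Finset.coe_univ, Set.image_univ]
  · apply top_le_iff.mp
    rw [← htop]
    exact IntermediateField.adjoin.mono k _ _ Algebra.subset_adjoin

end RegularCentre

/-! ## The reductions -/

section Reductions

/-- The case split behind both reductions: for a datum `(x, t, O)` of `Lupi`, either one of the
landed special cases applies (monomial modulo `p`-th powers, linear in one variable, regular
centre on the chart `k[x, t]`, trivial valuation, prime divisor, Abhyankar place), or the datum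
satisfies every exclusion of the reduced hypothesis `H`. -/
theorem isLocallyUniformizable_of_exclusions {p : ℕ} (hp : p.Prime) {k K : Type} [Field k]
    [CharP k p] [Field K] [Algebra k K] {n : ℕ} (x : Fin n → K) (t : K)
    (hx : AlgebraicIndependent k x) (htp : t ^ p ∈ Algebra.adjoin k (Set.range x))
    (htop : IntermediateField.adjoin k (insert t (Set.range x)) = ⊤)
    (O : ValuationSubring K) (hO : ∀ c : k, algebraMap k K c ∈ O)
    (H : (∀ (c : k) (a : Fin n → ℕ) (g : K), g ∈ IntermediateField.adjoin k (Set.range x) →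
          t ^ p ≠ algebraMap k K c * ∏ i, x i ^ a i + g ^ p) →
      (∀ (i₀ : Fin n) (g h : K), g ∈ Algebra.adjoin k (x '' ({i₀}ᶜ : Set (Fin n))) →
          h ∈ Algebra.adjoin k (x '' ({i₀}ᶜ : Set (Fin n))) → g ≠ 0 → t ^ p ≠ x i₀ * g + h) →
      (∀ hA : (Algebra.adjoin k (insert t (Set.range x))).toSubring ≤ O.toSubring,
          ¬ IsRegularLocalRing (Localization.AtPrime
            (Ideal.comap (Subring.inclusion hA) (IsLocalRing.maximalIdeal O)))) →
      O ≠ ⊤ → residueTrdeg k O hO + 1 ≠ n →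
      ¬ (IsAbhyankarPlace O (algebraMap k K).fieldRange ⊤ ∧
          SeparablyGeneratedOver (resField O (algebraMap k K).fieldRange) (resField O ⊤)) →
      IsLocallyUniformizable k K O) :
    IsLocallyUniformizable k K O := by
  by_cases hmon : ∃ (c : k) (a : Fin n → ℕ) (g : K), g ∈ IntermediateField.adjoin k (Set.range x) ∧
      t ^ p = algebraMap k K c * ∏ i, x i ^ a i + g ^ p
  · obtain ⟨c, a, g, hg, hta⟩ := hmon
    exact isLocallyUniformizable_of_pow_eq_monomial_add_pow x t hp hx c a hg hta htop O hO
  by_cases hlin : ∃ (i₀ : Fin n) (g h : K), g ∈ Algebra.adjoin k (x '' ({i₀}ᶜ : Set (Fin n))) ∧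
      h ∈ Algebra.adjoin k (x '' ({i₀}ᶜ : Set (Fin n))) ∧ g ≠ 0 ∧ t ^ p = x i₀ * g + h
  · obtain ⟨i₀, g, h, hg, hh, hg0, hta⟩ := hlin
    exact isLocallyUniformizable_of_pow_eq_linear x t hp.ne_zero hx hg hh hg0 hta htop O hO
  by_cases hreg : ∃ hA : (Algebra.adjoin k (insert t (Set.range x))).toSubring ≤ O.toSubring,
      IsRegularLocalRing (Localization.AtPrime
        (Ideal.comap (Subring.inclusion hA) (IsLocalRing.maximalIdeal O)))
  · obtain ⟨hA, hreg⟩ := hreg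
    exact isLocallyUniformizable_of_isRegularLocalRing_adjoin x t htop O hA hreg
  have hfg := fg_top_of_adjoin_eq_top x t htop
  by_cases hOtop : O = ⊤
  · subst hOtop
    exact isLocallyUniformizable_top hfg
  by_cases hF : residueTrdeg k O hO + 1 = n
  · refine isLocallyUniformizable_of_residueTrdeg O hO hfg hOtop ?_
    rw [hF, trdeg_eq x t hp.ne_zero hx htp htop]
  by_cases hAbh : IsAbhyankarPlace O (algebraMap k K).fieldRange ⊤ ∧
      SeparablyGeneratedOver (resField O (algebraMap k K).fieldRange) (resField O ⊤)
  · exact isLocallyUniformizable_of_isAbhyankarPlace hfg O hO hAbh.1 hAbh.2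
  push Not at hmon hlin hreg
  exact H (fun c a g hg => hmon c a g hg) (fun i₀ g h hg hh hg0 => hlin i₀ g h hg hh hg0) hreg hOtop
    hF hAbh

/-- **The induction on the number of variables.** If `Lupi` holds for every datum in normal
form (`xᵢ ∈ O`) whose `t ^ p` involves every variable, in every number of variables, then it
holds for every datum: put the datum in normal form (`exists_datum_mem`), and if some variable
is idle drop it (`isLocallyUniformizable_of_drop`, induction hypothesis in one fewer variable). -/
theorem forall_isLocallyUniformizable_of_forall_involves {p : ℕ} (hp : p ≠ 0) {k : Type}
    [Field k]
    (H : ∀ (K : Type) [Field K] [Algebra k K] (n : ℕ) (x : Fin n → K) (t : K),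
      AlgebraicIndependent k x → t ^ p ∈ Algebra.adjoin k (Set.range x) →
      IntermediateField.adjoin k (insert t (Set.range x)) = ⊤ →
      (∀ i₀ : Fin n, t ^ p ∉ Algebra.adjoin k (x '' ({i₀}ᶜ : Set (Fin n)))) →
      ∀ O : ValuationSubring K, (∀ c : k, algebraMap k K c ∈ O) → (∀ i, x i ∈ O) →
        IsLocallyUniformizable k K O)
    (n : ℕ) : ∀ (K : Type) [Field K] [Algebra k K] (x : Fin n → K) (t : K),
      AlgebraicIndependent k x → t ^ p ∈ Algebra.adjoin k (Set.range x) →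
      IntermediateField.adjoin k (insert t (Set.range x)) = ⊤ →
      ∀ O : ValuationSubring K, (∀ c : k, algebraMap k K c ∈ O) →
        IsLocallyUniformizable k K O := by
  induction n with
  | zero =>
    intro K _ _ x t hx htp htop O hO
    obtain ⟨y, t', hyO, hy, ht'p, htop'⟩ := exists_datum_mem x t hp hx htp htop O
    exact H K 0 y t' hy ht'p htop' (fun i₀ => Fin.elim0 i₀) O hO hyO
  | succ n ih =>
    intro K _ _ x t hx htp htop O hO
    obtain ⟨y, t', hyO, hy, ht'p, htop'⟩ := exists_datum_mem x t hp hx htp htop O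
    by_cases hdrop : ∃ i₀ : Fin (n + 1), t' ^ p ∈ Algebra.adjoin k (y '' ({i₀}ᶜ : Set (Fin (n + 1))))
    · obtain ⟨i₀, hi₀⟩ := hdrop
      exact isLocallyUniformizable_of_drop hp y t' hy i₀ hi₀ htop' O hO
        fun K₁ _ _ x₁ t₁ hx₁ htp₁ htop₁ O₁ hO₁ => ih K₁ x₁ t₁ hx₁ htp₁ htop₁ O₁ hO₁
    · push Not at hdrop
      exact H K (n + 1) y t' hy ht'p htop' hdrop O hO hyO

/-- **The open case of `Lupi`, unconditional reduction.** `Lupi` follows from its instances with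
`2 ≤ n`, every `xᵢ ∈ O`, `t ^ p` involving every variable, `t ^ p` neither of the shape
`c · xᵃ + g ^ p` (`c ∈ k`, `g ∈ k(x)`; this excludes `t ∈ k(x)` and `t ^ p ∈ k` as well) nor
linear in one of the variables, the centre of `O` a SINGULAR point of the chart `k[x, t]`,
`O ≠ K`, `O` not a prime divisor (`dim O + 1 ≠ n`), and `O` not an Abhyankar place with separably
generated residue field extension. -/
theorem lupi_of_reduced_two_full
    (H : ∀ p : ℕ, p.Prime → ∀ (k K : Type) [Field k] [CharP k p] [Field K] [Algebra k K]
      (n : ℕ) (x : Fin n → K) (t : K), 2 ≤ n → AlgebraicIndependent k x →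
      t ^ p ∈ Algebra.adjoin k (Set.range x) →
      IntermediateField.adjoin k (insert t (Set.range x)) = ⊤ →
      (∀ i₀ : Fin n, t ^ p ∉ Algebra.adjoin k (x '' ({i₀}ᶜ : Set (Fin n)))) →
      (∀ (c : k) (a : Fin n → ℕ) (g : K), g ∈ IntermediateField.adjoin k (Set.range x) →
          t ^ p ≠ algebraMap k K c * ∏ i, x i ^ a i + g ^ p) →
      (∀ (i₀ : Fin n) (g h : K), g ∈ Algebra.adjoin k (x '' ({i₀}ᶜ : Set (Fin n))) →
          h ∈ Algebra.adjoin k (x '' ({i₀}ᶜ : Set (Fin n))) → g ≠ 0 → t ^ p ≠ x i₀ * g + h) →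
      ∀ (O : ValuationSubring K) (hO : ∀ c : k, algebraMap k K c ∈ O), (∀ i, x i ∈ O) →
        (∀ hA : (Algebra.adjoin k (insert t (Set.range x))).toSubring ≤ O.toSubring,
          ¬ IsRegularLocalRing (Localization.AtPrime
            (Ideal.comap (Subring.inclusion hA) (IsLocalRing.maximalIdeal O)))) →
        O ≠ ⊤ → residueTrdeg k O hO + 1 ≠ n →
        ¬ (IsAbhyankarPlace O (algebraMap k K).fieldRange ⊤ ∧
            SeparablyGeneratedOver (resField O (algebraMap k K).fieldRange) (resField O ⊤)) →
        IsLocallyUniformizable k K O) : Lupi := by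
  intro p hp k K _ _ _ _ n x t hx htp htop O hO
  refine forall_isLocallyUniformizable_of_forall_involves hp.ne_zero (k := k) ?_ n K x t hx htp
    htop O hO
  intro K _ _ n x t hx htp htop hinv O hO hxO
  by_cases hn : n ≤ 1
  · exact isLocallyUniformizable_of_le_one hn x t hp.ne_zero hx htp htop O hO
  exact isLocallyUniformizable_of_exclusions hp x t hx htp htop O hO
    fun hmon hlin hreg hOtop hF hAbh =>
      H p hp k K n x t (by omega) hx htp htop hinv hmon hlin O hO hxO hreg hOtop hF hAbh

/-- **The open case of `Lupi` modulo Cossart–Jannsen–Saito** (resolution of excellent surfaces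
only): the same reduction with `3 ≤ n` (`n ≤ 2`: `isLocallyUniformizable_of_le_two`). -/
theorem lupi_of_reduced_three_full (hCJS : CossartJannsenSaito2020.{0})
    (H : ∀ p : ℕ, p.Prime → ∀ (k K : Type) [Field k] [CharP k p] [Field K] [Algebra k K]
      (n : ℕ) (x : Fin n → K) (t : K), 3 ≤ n → AlgebraicIndependent k x →
      t ^ p ∈ Algebra.adjoin k (Set.range x) →
      IntermediateField.adjoin k (insert t (Set.range x)) = ⊤ →
      (∀ i₀ : Fin n, t ^ p ∉ Algebra.adjoin k (x '' ({i₀}ᶜ : Set (Fin n)))) →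
      (∀ (c : k) (a : Fin n → ℕ) (g : K), g ∈ IntermediateField.adjoin k (Set.range x) →
          t ^ p ≠ algebraMap k K c * ∏ i, x i ^ a i + g ^ p) →
      (∀ (i₀ : Fin n) (g h : K), g ∈ Algebra.adjoin k (x '' ({i₀}ᶜ : Set (Fin n))) →
          h ∈ Algebra.adjoin k (x '' ({i₀}ᶜ : Set (Fin n))) → g ≠ 0 → t ^ p ≠ x i₀ * g + h) →
      ∀ (O : ValuationSubring K) (hO : ∀ c : k, algebraMap k K c ∈ O), (∀ i, x i ∈ O) →
        (∀ hA : (Algebra.adjoin k (insert t (Set.range x))).toSubring ≤ O.toSubring,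
          ¬ IsRegularLocalRing (Localization.AtPrime
            (Ideal.comap (Subring.inclusion hA) (IsLocalRing.maximalIdeal O)))) →
        O ≠ ⊤ → residueTrdeg k O hO + 1 ≠ n →
        ¬ (IsAbhyankarPlace O (algebraMap k K).fieldRange ⊤ ∧
            SeparablyGeneratedOver (resField O (algebraMap k K).fieldRange) (resField O ⊤)) →
        IsLocallyUniformizable k K O) : Lupi := by
  intro p hp k K _ _ _ _ n x t hx htp htop O hO
  refine forall_isLocallyUniformizable_of_forall_involves hp.ne_zero (k := k) ?_ n K x t hx htp
    htop O hO
  intro K _ _ n x t hx htp htop hinv O hO hxO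
  by_cases hn : n ≤ 2
  · exact isLocallyUniformizable_of_le_two hCJS hn x t hp.ne_zero hx htp htop O hO
  exact isLocallyUniformizable_of_exclusions hp x t hx htp htop O hO
    fun hmon hlin hreg hOtop hF hAbh =>
      H p hp k K n x t (by omega) hx htp htop hinv hmon hlin O hO hxO hreg hOtop hF hAbh

/-- **The open case of `Lupi` modulo Cossart–Piltant.** Given the vendored fact
`CossartPiltant2019` (dimension `≤ 3`), `Lupi` follows from its instances with `4 ≤ n`, every
`xᵢ ∈ O`, `t ^ p` involving every variable, `t ^ p` neither of the shape `c · xᵃ + g ^ p`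
(`c ∈ k`, `g ∈ k(x)`) nor linear in one of the variables, the centre of `O` a singular point of
the chart `k[x, t]`, `O ≠ K`, `O` not a prime divisor, and `O` not an Abhyankar place with
separably generated residue field extension — the open case as printed (Temkin 2013
Rem. 1.3.5(iii), Cutkosky–Mourtada 2019), minus the toric / rational, regular, divisorial and
defectless-Abhyankar instances the tree proves. -/
theorem lupi_of_reduced_full (hCP : CossartPiltant2019.{0})
    (H : ∀ p : ℕ, p.Prime → ∀ (k K : Type) [Field k] [CharP k p] [Field K] [Algebra k K]
      (n : ℕ) (x : Fin n → K) (t : K), 4 ≤ n → AlgebraicIndependent k x →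
      t ^ p ∈ Algebra.adjoin k (Set.range x) →
      IntermediateField.adjoin k (insert t (Set.range x)) = ⊤ →
      (∀ i₀ : Fin n, t ^ p ∉ Algebra.adjoin k (x '' ({i₀}ᶜ : Set (Fin n)))) →
      (∀ (c : k) (a : Fin n → ℕ) (g : K), g ∈ IntermediateField.adjoin k (Set.range x) →
          t ^ p ≠ algebraMap k K c * ∏ i, x i ^ a i + g ^ p) →
      (∀ (i₀ : Fin n) (g h : K), g ∈ Algebra.adjoin k (x '' ({i₀}ᶜ : Set (Fin n))) →
          h ∈ Algebra.adjoin k (x '' ({i₀}ᶜ : Set (Fin n))) → g ≠ 0 → t ^ p ≠ x i₀ * g + h) →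
      ∀ (O : ValuationSubring K) (hO : ∀ c : k, algebraMap k K c ∈ O), (∀ i, x i ∈ O) →
        (∀ hA : (Algebra.adjoin k (insert t (Set.range x))).toSubring ≤ O.toSubring,
          ¬ IsRegularLocalRing (Localization.AtPrime
            (Ideal.comap (Subring.inclusion hA) (IsLocalRing.maximalIdeal O)))) →
        O ≠ ⊤ → residueTrdeg k O hO + 1 ≠ n →
        ¬ (IsAbhyankarPlace O (algebraMap k K).fieldRange ⊤ ∧
            SeparablyGeneratedOver (resField O (algebraMap k K).fieldRange) (resField O ⊤)) →
        IsLocallyUniformizable k K O) : Lupi := by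
  intro p hp k K _ _ _ _ n x t hx htp htop O hO
  refine forall_isLocallyUniformizable_of_forall_involves hp.ne_zero (k := k) ?_ n K x t hx htp
    htop O hO
  intro K _ _ n x t hx htp htop hinv O hO hxO
  by_cases hn : n ≤ 3
  · exact isLocallyUniformizable_of_le_three hCP hn x t hp.ne_zero hx htp htop O hO
  exact isLocallyUniformizable_of_exclusions hp x t hx htp htop O hO
    fun hmon hlin hreg hOtop hF hAbh =>
      H p hp k K n x t (by omega) hx htp htop hinv hmon hlin O hO hxO hreg hOtop hF hAbh

end Reductions

end Summit.ResolutionOfSingularities.ResolutionOfSingularities.Theorems.Lupi
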